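import Mathlib
import Summits.Ventures.PercRepro.TriangleCapBandComplete
import Summits.Ventures.PercRepro.TriangleCapSubBandDeep

/-!
# PercRepro — THE COMPLETE BAND IN CLOSED FORM: `ℓ = 3` FOR EVERY `t ≥ 4`, EVERY `ℓ ≥ 3` FROM THE DEPTH `2 ⌊√t⌋`
(p3, gen 53; part 270)

Two explicit depths discharge the overlap hypothesis of part 269's `band_complete`:
* `u₁ = ⌊(t − 1)/3⌋` (`t ≤ 3 u₁ + 3`): the width is at least `u₁` (`twoW_ge_two_mul`), so the sub-bands `u₁` and
  `u₁ + 1` overlap (`overlap_of_three_le`), and `3 u₁ < t` is the structure hypothesis of part 266 — **THE COMPLETE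
  BAND ON `4 + (s − t)` VERTICES** (`band_three_complete`, `4 ≤ t`, `2 t ≤ s`): `2 j` is attained IFF `j < B(u₁)` and
  `j` lies in a sub-band interval `u < u₁` (`B(u) ≤ j`, `2 j + 2 q u ≤ 2 B(u) + u (u + 1) + 2 q (q + 1)`,
  `q = max 1 ⌊u/2⌋`), or `B(u₁) ≤ j` and `2 j + 2 ⌊t/3⌋ t ≤ t (t − 1) + 3 ⌊t/3⌋ (⌊t/3⌋ + 1)`.
* `u₁ = 2 ⌊√t⌋`: the balanced collision count satisfies `(ℓ − 1) · coll ≤ u (u − 1)` (`coll_lfRR_zero_mul_le`), so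
  `(ℓ − 1) twoW ℓ u + u (u − 1) ≥ (ℓ − 1) u (u + 1)` (`twoW_mul_ge`) — the width grows like `u²/2` at least, and the
  overlap holds as soon as `2 (ℓ − 1)(t − 2 u − 2) ≤ (ℓ − 2) u (u + 1) + 2 u + 2 (ℓ − 1)` (`overlap_of_sq`), which
  `u = 2 ⌊√t⌋` satisfies for every `ℓ ≥ 3` (`t ≤ r² + 2 r`, `r = ⌊√t⌋`); with `t ≥ 64` the structure hypothesis
  `4 (u₁ − 1) + 3 ≤ t` holds too: **THE BAND IS ONE INTERVAL FROM `B(2 ⌊√t⌋) ≈ 2 t √t` TO ITS EXTREMAL VALUE**, with the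
  sub-band intervals below (`band_complete_sqrt`, every `ℓ ≥ 3` with `ℓ + 2 ⌊√t⌋ ≤ t`, `ℓ + ⌊t/2⌋ ≤ t + 1`).
Axioms: standard.
-/

namespace PercRepro

namespace TriangleCap

namespace C047

open Finset

/-- The width is at least `u`: `2 u ≤ twoW ℓ u`. -/
theorem twoW_ge_two_mul (ℓ u : ℕ) : 2 * u ≤ twoW ℓ u := by
  unfold twoW
  have := two_mul_width_ge u (ℓ - 1)
  omega

/-- **THE OVERLAP FOR `t ≤ 3 u + 3`:** `2 B(u + 1) ≤ 2 B(u) + twoW ℓ u + 2`. -/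
theorem overlap_of_three_le (ℓ t u : ℕ) (h : t ≤ 3 * u + 3) :
    2 * ((u + 1) * (t - u - 2)) ≤ 2 * (u * (t - u - 1)) + twoW ℓ u + 2 := by
  have h1 := subband_overlap t u h
  have h2 := twoW_ge_two_mul ℓ u
  have e : t - (u + 1) - 1 = t - u - 2 := by omega
  rw [e] at h1
  omega

/-- **THE COMPLETE BAND ON `4 + (s − t)` VERTICES** (three non-neighbours of the vertex of degree `s − t`; `4 ≤ t`,
`2 t ≤ s`), with `u₁ = ⌊(t − 1)/3⌋`: the band value `2 j` is attained IFF either `j < u₁ (t − u₁ − 1)` and `j` lies in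
a sub-band interval `u < u₁` (`u (t − u − 1) ≤ j` and `2 j + 2 q u ≤ 2 u (t − u − 1) + u (u + 1) + 2 q (q + 1)` at
`q = subQ 3 u = max 1 ⌊u/2⌋`), or `u₁ (t − u₁ − 1) ≤ j` and `2 j + 2 ⌊t/3⌋ t ≤ t (t − 1) + 3 ⌊t/3⌋ (⌊t/3⌋ + 1)`. -/
theorem band_three_complete (s t j : ℕ) (ht : 4 ≤ t) (hs : 2 * t ≤ s) :
    (∃ (H : SimpleGraph (Fin (3 + 1 + (s - t)))) (_ : DecidableRel H.Adj), H.CliqueFree 3 ∧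
      H.edgeFinset.card = s ∧ (∃ w, deg H w + t = s) ∧
      ∑ v, deg H v * deg H v + 2 * (t * (s - t - 1)) + 2 * j = s * (s + 1)) ↔
    ((j < ((t - 1) / 3) * (t - (t - 1) / 3 - 1) ∧ ∃ u, u + 1 ≤ (t - 1) / 3 ∧ u * (t - u - 1) ≤ j ∧
        2 * j + 2 * (subQ 3 u * u) ≤ 2 * (u * (t - u - 1)) + u * (u + 1) + (3 - 1) * (subQ 3 u * (subQ 3 u + 1))) ∨
      (((t - 1) / 3) * (t - (t - 1) / 3 - 1) ≤ j ∧
        2 * j + 2 * (t / 3) * t ≤ t * (t - 1) + 3 * ((t / 3) * (t / 3 + 1)))) := by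
  apply band_complete 3 s t ((t - 1) / 3) j (by norm_num) (by omega) hs (by omega) (by omega) (by omega) (by omega)
  · exact overlap_of_three_le 3 t ((t - 1) / 3) (by omega)
  · right
    omega

/-- **THE BALANCED COLLISION COUNT IS AT MOST `u (u − 1) / k`:** `k · coll u (lfRR k 0) ≤ u (u − 1)` for `1 ≤ k`. -/
theorem coll_lfRR_zero_mul_le (k u : ℕ) (hk : 1 ≤ k) : k * coll u (lfRR k 0) ≤ u * (u - 1) := by
  rw [coll_lfRR_zero k u hk]
  have hdiv := Nat.div_add_mod u k
  have hmod := Nat.mod_lt u (show 0 < k by omega)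
  obtain ⟨q, hq⟩ : ∃ q, u / k = q := ⟨_, rfl⟩
  obtain ⟨ρ, hρ⟩ : ∃ ρ, u % k = ρ := ⟨_, rfl⟩
  rw [hq, hρ] at hdiv ⊢
  rw [hρ] at hmod
  rw [← hdiv]
  obtain ⟨k', rfl⟩ : ∃ k', k = k' + 1 := ⟨k - 1, by omega⟩
  rcases Nat.eq_zero_or_pos q with rfl | hq0
  · -- no full round: the collision count is `0`
    simp
  · obtain ⟨q', rfl⟩ : ∃ q', q = q' + 1 := ⟨q - 1, by omega⟩
    rw [Nat.add_sub_cancel]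
    rcases Nat.eq_zero_or_pos ρ with rfl | hρ0
    · have e : (k' + 1) * (q' + 1) + 0 - 1 = (k' + 1) * q' + k' := by
        have : (k' + 1) * (q' + 1) = (k' + 1) * q' + k' + 1 := by ring
        omega
      rw [e]
      nlinarith [Nat.zero_le (k' * ((k' + 1) * (q' + 1)))]
    · obtain ⟨ρ', rfl⟩ : ∃ ρ', ρ = ρ' + 1 := ⟨ρ - 1, by omega⟩
      have e : (k' + 1) * (q' + 1) + (ρ' + 1) - 1 = (k' + 1) * (q' + 1) + ρ' := by omega
      rw [e]
      nlinarith [Nat.zero_le (k' * ((k' + 1) * (q' + 1))), Nat.zero_le (ρ' * (ρ' + 1))]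

/-- **THE WIDTH GROWS QUADRATICALLY:** `(ℓ − 1) twoW ℓ u + u (u − 1) ≥ (ℓ − 1) u (u + 1)` for `2 ≤ ℓ`. -/
theorem twoW_mul_ge (ℓ u : ℕ) (hℓ : 2 ≤ ℓ) :
    (ℓ - 1) * (u * (u + 1)) ≤ (ℓ - 1) * twoW ℓ u + u * (u - 1) := by
  unfold twoW
  have h1 := coll_lfRR_zero_mul_le (ℓ - 1) u (by omega)
  have h2 := coll_le u (lfRR (ℓ - 1) 0)
  have hu1 : u * (u - 1) ≤ u * (u + 1) := Nat.mul_le_mul_left u (by omega)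
  have h3 : (ℓ - 1) * (u * (u + 1) - coll u (lfRR (ℓ - 1) 0) + 2 * (ℓ - 1 - u)) ≥
      (ℓ - 1) * (u * (u + 1) - coll u (lfRR (ℓ - 1) 0)) := Nat.mul_le_mul_left _ (by omega)
  have h4 : (ℓ - 1) * (u * (u + 1) - coll u (lfRR (ℓ - 1) 0)) + (ℓ - 1) * coll u (lfRR (ℓ - 1) 0) =
      (ℓ - 1) * (u * (u + 1)) := by
    rw [← Nat.mul_add, Nat.sub_add_cancel (by omega)]
  omega

/-- **THE OVERLAP FROM THE QUADRATIC WIDTH:** for `2 ≤ ℓ`, if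
`2 (ℓ − 1)(t − 2 u − 2) ≤ (ℓ − 2) u (u + 1) + 2 u + 2 (ℓ − 1)` then `2 B(u + 1) ≤ 2 B(u) + twoW ℓ u + 2`. -/
theorem overlap_of_sq (ℓ t u : ℕ) (hℓ : 2 ≤ ℓ)
    (h : 2 * ((ℓ - 1) * (t - 2 * u - 2)) ≤ (ℓ - 2) * (u * (u + 1)) + 2 * u + 2 * (ℓ - 1)) :
    2 * ((u + 1) * (t - u - 2)) ≤ 2 * (u * (t - u - 1)) + twoW ℓ u + 2 := by
  have hW := twoW_mul_ge ℓ u hℓ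
  rcases Nat.lt_or_ge t (2 * u + 3) with hlt | hge
  · -- the bottoms do not rise: `B(u + 1) ≤ B(u)`
    rcases Nat.lt_or_ge t (u + 2) with hlt2 | hge2
    · have e : t - u - 2 = 0 := by omega
      rw [e, mul_zero, mul_zero]
      exact Nat.zero_le _
    · obtain ⟨d, rfl⟩ : ∃ d, t = u + 2 + d := ⟨t - u - 2, by omega⟩
      have e1 : u + 2 + d - u - 2 = d := by omega
      have e2 : u + 2 + d - u - 1 = d + 1 := by omega
      rw [e1, e2]
      have hdu : d ≤ u := by omega
      have : (u + 1) * d ≤ u * (d + 1) := by nlinarith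
      omega
  · obtain ⟨d, rfl⟩ : ∃ d, t = 2 * u + 3 + d := ⟨t - 2 * u - 3, by omega⟩
    have e1 : 2 * u + 3 + d - u - 2 = u + 1 + d := by omega
    have e2 : 2 * u + 3 + d - u - 1 = u + 2 + d := by omega
    have e3 : 2 * u + 3 + d - 2 * u - 2 = d + 1 := by omega
    rw [e1, e2]
    rw [e3] at h
    -- `2 (u + 1)(u + 1 + d) = 2 u (u + 2 + d) + 2 (d + 1)`: the bottoms rise by `2 (d + 1)`; need
    -- `2 (d + 1) ≤ twoW + 2`, i.e. `2 d ≤ twoW`, from `(ℓ − 1) · 2 d ≤ (ℓ − 1) twoW`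
    have f1 : (u + 1) * (u + 1 + d) = u * (u + 2 + d) + d + 1 := by ring
    rw [f1]
    obtain ⟨k, rfl⟩ : ∃ k, ℓ = k + 2 := ⟨ℓ - 2, by omega⟩
    have e4 : k + 2 - 1 = k + 1 := by omega
    have e5 : k + 2 - 2 = k := by omega
    rw [e4] at hW
    rw [e4, e5] at h
    have hu : u * (u + 1) = u * (u - 1) + 2 * u := by
      rcases u with _ | u'
      · simp
      · rw [Nat.add_sub_cancel]
        ring
    have key : (k + 1) * (2 * d) ≤ (k + 1) * twoW (k + 2) u := by
      nlinarith [h, hW, hu]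
    have := Nat.le_of_mul_le_mul_left key (by omega : 0 < k + 1)
    omega

/-- **THE COMPLETE BAND FROM THE DEPTH `2 ⌊√t⌋`, EVERY `ℓ ≥ 3`** (`64 ≤ t`, `ℓ + 2 ⌊√t⌋ ≤ t`, `ℓ + ⌊t/2⌋ ≤ t + 1`,
`2 t ≤ s`), with `u₁ = 2 ⌊√t⌋`: the band value `2 j` is attained on `ℓ + 1 + (s − t)` vertices IFF either
`j < u₁ (t − u₁ − 1)` and `j` lies in a sub-band interval `u < u₁`, or `u₁ (t − u₁ − 1) ≤ j` and
`2 j + 2 ⌊t/ℓ⌋ t ≤ t (t − 1) + ℓ ⌊t/ℓ⌋ (⌊t/ℓ⌋ + 1)`. -/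
theorem band_complete_sqrt (ℓ s t j : ℕ) (hℓ : 3 ≤ ℓ) (ht : 64 ≤ t) (hℓt : ℓ + 2 * Nat.sqrt t ≤ t)
    (hℓt2 : ℓ + t / 2 ≤ t + 1) (hs : 2 * t ≤ s) :
    (∃ (H : SimpleGraph (Fin (ℓ + 1 + (s - t)))) (_ : DecidableRel H.Adj), H.CliqueFree 3 ∧
      H.edgeFinset.card = s ∧ (∃ w, deg H w + t = s) ∧
      ∑ v, deg H v * deg H v + 2 * (t * (s - t - 1)) + 2 * j = s * (s + 1)) ↔
    ((j < (2 * Nat.sqrt t) * (t - 2 * Nat.sqrt t - 1) ∧ ∃ u, u + 1 ≤ 2 * Nat.sqrt t ∧ u * (t - u - 1) ≤ j ∧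
        2 * j + 2 * (subQ ℓ u * u) ≤ 2 * (u * (t - u - 1)) + u * (u + 1) + (ℓ - 1) * (subQ ℓ u * (subQ ℓ u + 1))) ∨
      ((2 * Nat.sqrt t) * (t - 2 * Nat.sqrt t - 1) ≤ j ∧
        2 * j + 2 * (t / ℓ) * t ≤ t * (t - 1) + ℓ * ((t / ℓ) * (t / ℓ + 1)))) := by
  have hr8 : 8 ≤ Nat.sqrt t := Nat.le_sqrt.mpr (by omega)
  have hrt := Nat.sqrt_le_add t
  have hrr := Nat.sqrt_le t
  obtain ⟨r, hr⟩ : ∃ r, Nat.sqrt t = r := ⟨_, rfl⟩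
  rw [hr] at hr8 hrt hrr hℓt ⊢
  apply band_complete ℓ s t (2 * r) j (by omega) (by omega) hs (by omega) (by nlinarith) hℓt hℓt2
  · apply overlap_of_sq ℓ t (2 * r) (by omega)
    -- `t ≤ r² + 2 r`: `2 (ℓ − 1)(t − 4 r − 2) ≤ 2 (ℓ − 1)(r² − 2 r − 2) ≤ (ℓ − 2)(4 r² + 2 r) + 4 r + 2 (ℓ − 1)`
    obtain ⟨k, rfl⟩ : ∃ k, ℓ = k + 3 := ⟨ℓ - 3, by omega⟩
    have e1 : k + 3 - 1 = k + 2 := by omega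
    have e2 : k + 3 - 2 = k + 1 := by omega
    rw [e1, e2]
    have hsub : t - 2 * (2 * r) - 2 ≤ r * r - 2 * r - 2 := by omega
    have hrr2 : 2 * r + 2 ≤ r * r := by nlinarith
    obtain ⟨m, hm⟩ : ∃ m, r * r = 2 * r + 2 + m := ⟨r * r - 2 * r - 2, by omega⟩
    have hsub' : t - 2 * (2 * r) - 2 ≤ m := by omega
    have e3 : 2 * r * (2 * r + 1) = 4 * m + 10 * r + 8 := by
      rw [show 2 * r * (2 * r + 1) = 4 * (r * r) + 2 * r by ring, hm]
      ring
    rw [e3]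
    calc 2 * ((k + 2) * (t - 2 * (2 * r) - 2)) ≤ 2 * ((k + 2) * m) := by gcongr
      _ ≤ (k + 1) * (4 * m + 10 * r + 8) + 2 * (2 * r) + 2 * (k + 2) := by
        nlinarith [Nat.zero_le (k * m), Nat.zero_le (k * r)]
  · left
    have h8r : 8 * r ≤ t := by nlinarith
    omega

end C047

end TriangleCap

end PercRepro
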